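import Summits.NavierStokesRegularity.NavierStokesRegularity.Theorems.SwirlFreeBudgetEtaReverseHolder
import Summits.NavierStokesRegularity.NavierStokesRegularity.Theorems.SwirlFreeBudgetMeridional
import HarnessLib

/-!
# SwirlFreeBudget: the swirl-free rung `N₀^{full}` of ROUND-17/18 is a THEOREM (seat nsreg-p4 g13)

Support file for the DORMANT route `SwirlThreshold` (crux stmt-NavierStokesRegularity-2002) and
planner nsreg-p2's ROUND-18 (`…Theorems.SwirlFreeBudget`, `…SwirlFreeBudgetMeridional`).  With
K-18.1 `EtaMoserBound` and P₀ `SwirlFreePolynomialBound` proved (sibling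
`…SwirlFreeBudgetEtaReverseHolder`), the landed joins give the budget law UNCONDITIONALLY:

* `swirlFreeBudget_holds` — **N₀^{full} `SwirlFreeBudget Pe κ₀` for EVERY velocity-dominated gauge
  `Pe` and every `κ₀ > 0`** (join `swirlFreeBudget_of_polynomialBound`);
* `meridionalBudget_holds` — **N₀^{full} for the meridional Péclet gauge** (ROUND-17's
  `MeridionalSwirlLaw κ` at `a = b` in the full CKN gauge; join `meridionalBudget_of_polynomialBound`,
  S-18.1 `meridionalPecletDominated_holds`).

WHAT THIS IS NOT: not NS regularity — the swirl-free end (`a = b`) of the R16/R17 tower only; the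
with-swirl budget `MeridionalSwirlLaw κ` for `b > a` (crux stmt-2002), the A-only versions
(`SwirlFreePolynomialBoundA`, open) and all hard cores untouched; no crux claim.
-/

-- the problem directory repeats the summit name (D-0017); core's `dupNamespace` linter fires
set_option linter.dupNamespace false

namespace Summit.NavierStokesRegularity.NavierStokesRegularity.Theorems.SwirlFreeBudget

open scoped ENNReal
open Summit.NavierStokesRegularity.NavierStokesRegularity.Theorems.MeridionalBarrier (meridionalPeclet)

noncomputable section

/-- **N₀^{full} is a theorem for every velocity-dominated gauge**: for `Pe` velocity-dominated with
constant `c₁ ≥ 0` and every `κ₀ > 0`, `SwirlFreeBudget Pe κ₀` holds (P₀ is proved). -/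
theorem swirlFreeBudget_holds {c₁ : ℝ}
    {Pe : ℝ → ℝ × EuclideanSpace ℝ (Fin 3) →
      (ℝ → EuclideanSpace ℝ (Fin 3) → EuclideanSpace ℝ (Fin 3)) → ℝ≥0∞}
    (hc₁ : 0 ≤ c₁) (hPe : VelocityDominated c₁ Pe) {κ₀ : ℝ} (hκ₀ : 0 < κ₀) : SwirlFreeBudget Pe κ₀ :=
  swirlFreeBudget_of_polynomialBound hc₁ hPe swirlFreePolynomialBound_holds hκ₀

/-- **N₀^{full} for the meridional Péclet gauge is a theorem**: ROUND-17's `MeridionalSwirlLaw κ₀`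
at `a = b` in the full CKN gauge, for every `κ₀ > 0`. -/
theorem meridionalBudget_holds {κ₀ : ℝ} (hκ₀ : 0 < κ₀) : SwirlFreeBudget meridionalPeclet κ₀ :=
  meridionalBudget_of_polynomialBound swirlFreePolynomialBound_holds hκ₀

end

end Summit.NavierStokesRegularity.NavierStokesRegularity.Theorems.SwirlFreeBudget
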